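import Literature.MathematicalPhysics.QuantumFieldTheory.BalabanImbrieJaffe1984to88.BIJ88Eq596Passage

/-!
# `BalabanImbrieJaffe1984to88.BIJ88Eq596Exists` — T. Bałaban, J. Imbrie, A. Jaffe, *Effective action and cluster properties of the
abelian Higgs model*, Commun. Math. Phys. **114** (1988) 257–315 [BalabanImbrieJaffe1988], (5.9.6) p. 297 [PDF 41] with p. 282 [PDF 26]
*"a different density is obtained by replacing ψ′ with ψ"*: **EXISTENCE OF THE DENSITY FOR A GIVEN BRACKET** — for every finite family of
`fieldsMeasure ν`-integrable one-integrand data `G_t({u^{(j)}}, u, φ, ψ)` (resp. brackets `J_t({u^{(j)}}, u^{(k)}, v, φ^{(k)}, ψ)` of line 1 of (5.9.6))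
there IS a `dv dψ`-integrable density satisfying the display `IsRDG ν terms Q G` (resp. `IsDT ν terms Λ Q J`) of `BIJ88Eq596Display`, constructed
as in gen 6 (`BIJ88RT51Exists.rt51` for (5.1.1)): the sum over the terms of the complex Radon–Nikodym densities w.r.t. `dv dψ` of the
push-forwards along `(u, ψ) ↦ (Qu, ψ)` of the `({u^{(j)}}, φ)`-smeared brackets (gen 6's engine `BIJ88RT51Density.rnC`, `integral_rnC_mul`), the
Haar regularity `ν.map Q ≪ dv` of the printed block average being r18's `absolutelyContinuous_map_qU` (`𝒟u δ_{Ax}`) / `map_qU_fieldMeasure` (`𝒟u`).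
This is what makes the operations of Sect. 5 that CHANGE the density — the renaming of p. 282 (`BIJ88RT54ScalarSubst.integral_eq_of_rename`:
*"a different density is obtained"*) — statements about an actual object: the new density exists and is unique a.e.
(`BIJ88Eq596Display.isDT_unique`).  Seat p34 gen 9, file 1c.

statement-level skeleton of published theorems with citation tags; proofs where landed; nothing here is a claim about the Yang–Mills mass gap

PDF held: `paper:balaban1988-cmp114-bij-abelian-higgs-effective-action` (journal page = PDF page + 256); pp. 277, 282, 297 [PDF 21, 26, 41].
CITATION HEADER (lean-in-tree rule).  Part of the lit-balaban TYPED SKELETON (HOME `run/shared/lean/pub/lit-balaban/`), PHASE-2 proof seat p34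
gen 9 (unit `lit-balaban-p34-g9`; TAKING line HOME/STATUS.md 2026-08-21T21:12:57Z; own lineage).  Rows served: support `C2.Eq5.9.6`,
`C2.Eq5.4.1-5.4.6` (p. 282, the renamed density exists), `C2.Eq5.1.1-5.1.4` (gen 6's existence extended to general brackets).

WHAT IS PROVED (two defs with bodies — the constructed densities —, theorems; 0 `sorry`; no `Prop`-valued fact; standard axioms).
* §1 `measurePreserving_shuffle` (`((u, ψ), ({u^{(j)}}, φ)) ↦ (u, {u^{(j)}}, φ, ψ)`), `smearG G` (the `({u^{(j)}}, φ)`-smeared bracket, a weight in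
  `(u, ψ)`), `integrable_smearG`, `integral_smearG_mul` (Fubini).
* §2 **`rdg ν terms Qu G`** (def) — the constructed density; `integrable_rdg`; **`isRDG_rdg`** (it satisfies the one-integrand display: `ν` s-finite,
  `Qu` measurable with `ν.map Qu ≪ dv`, `G_t` integrable); instances `_axial`, `_field` for the printed `Q`; `isRDG_iff_ae_eq_rdg`.
* §3 **`rdt ν terms Λ J`** (def) — the density of a bracket of line 1 of (5.9.6) (`rdg` of the bracket read in the untranslated variable,
  `G_t = J_t(u′_Λ(u), Qu)`); **`isDT_rdt`** (via `BIJ88Eq596Passage.isDT_of_isRDG`), `integrable_rdt`, instances, `isDT_iff_ae_eq_rdt`.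
Imports `BIJ88Eq596Passage` (Literature + Mathlib only).
-/

namespace Literature.MathematicalPhysics.QuantumFieldTheory.BalabanImbrieJaffe1984to88.BIJ88Eq596Exists

open Literature.MathematicalPhysics.QuantumFieldTheory.Balaban1983to89
open BIJ88Sect3Statements (U1)
open BIJ85Sect1Model (HiggsField)
open BIJ88RenormTransf311 (axialMeasure)
open BIJ88InductiveForm41 (Prev prevMeasure)
open BIJ85BlockAveragesTorus (qU surfMul measurable_qU map_surfMul_fieldMeasure map_qU_fieldMeasure absolutelyContinuous_map_qU)
open BIJ88Eq536Linearization (cutoff)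
open BIJ88Eq531TranslLaw (axialMeasure_map_surfMul)
open BIJ88RT52Restrictions (Fields fieldsMeasure integral_fieldsMeasure)
open BIJ88RT51Density (rnC measurable_rnC integrable_rnC integral_rnC_mul)
open BIJ88RT51Unique (ae_eq_of_forall_test)
open BIJ88Eq596Display (uCut vCut IsRDG IsDT qU_translCut' cutoff_vCut uCut_translCut translCut_uCut_qU isRDG_unique isRDG_congr_ae
  isDT_unique isDT_congr_ae)
open BIJ88Eq596Passage (isDT_of_isRDG)
open scoped BigOperators ENNReal
open _root_.MeasureTheory _root_.MeasureTheory.Measure Complex Function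

noncomputable section

variable {P : Params} {k : ℕ}

/-! ## §1 The smeared bracket: a weight in `(u, ψ)` -/

section Smear

variable {ν : Measure (GaugeField P k U1)} [SFinite ν]

/-- kernel: the shuffle `((u, ψ), ({u^{(j)}}, φ)) ↦ (u, ({u^{(j)}}, (φ, ψ)))` carries `(ν ⊗ dψ) ⊗ (Π𝒟u^{(j)} ⊗ 𝒟φ)` to gen 8's `fieldsMeasure ν` (swaps and
re-associations of s-finite factors). [folklore] -/
private theorem measurePreserving_shuffle :
    MeasurePreserving (fun r : (GaugeField P k U1 × HiggsField P (k+1)) × (Prev P k × HiggsField P k) =>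
        ((r.1.1, (r.2.1, (r.2.2, r.1.2))) : Fields P k))
      ((ν.prod (volume : Measure (HiggsField P (k+1)))).prod ((prevMeasure P k).prod (volume : Measure (HiggsField P k))))
      (fieldsMeasure ν) := by
  set dψ : Measure (HiggsField P (k+1)) := volume
  set dp : Measure (Prev P k) := prevMeasure P k
  set dφ : Measure (HiggsField P k) := volume
  have h1 : MeasurePreserving (MeasurableEquiv.prodAssoc : (GaugeField P k U1 × HiggsField P (k+1)) × (Prev P k × HiggsField P k) →
      GaugeField P k U1 × (HiggsField P (k+1) × (Prev P k × HiggsField P k))) ((ν.prod dψ).prod (dp.prod dφ)) (ν.prod (dψ.prod (dp.prod dφ))) :=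
    measurePreserving_prodAssoc ν dψ (dp.prod dφ)
  have h2 : MeasurePreserving (Prod.swap : HiggsField P (k+1) × (Prev P k × HiggsField P k) → (Prev P k × HiggsField P k) × HiggsField P (k+1))
      (dψ.prod (dp.prod dφ)) ((dp.prod dφ).prod dψ) := measurePreserving_swap
  have h3 : MeasurePreserving (MeasurableEquiv.prodAssoc : (Prev P k × HiggsField P k) × HiggsField P (k+1) → Prev P k × (HiggsField P k ×
      HiggsField P (k+1))) ((dp.prod dφ).prod dψ) (dp.prod (dφ.prod dψ)) := measurePreserving_prodAssoc dp dφ dψ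
  have h4 : MeasurePreserving (Prod.map (id : GaugeField P k U1 → GaugeField P k U1)
      ((MeasurableEquiv.prodAssoc : (Prev P k × HiggsField P k) × HiggsField P (k+1) → _) ∘
        (Prod.swap : HiggsField P (k+1) × (Prev P k × HiggsField P k) → _)))
      (ν.prod (dψ.prod (dp.prod dφ))) (ν.prod (dp.prod (dφ.prod dψ))) := (MeasurePreserving.id ν).prod (h3.comp h2)
  have e : (fun r : (GaugeField P k U1 × HiggsField P (k+1)) × (Prev P k × HiggsField P k) => ((r.1.1, (r.2.1, (r.2.2, r.1.2))) : Fields P k)) =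
      (Prod.map (id : GaugeField P k U1 → GaugeField P k U1)
        ((MeasurableEquiv.prodAssoc : (Prev P k × HiggsField P k) × HiggsField P (k+1) → _) ∘
          (Prod.swap : HiggsField P (k+1) × (Prev P k × HiggsField P k) → _))) ∘
      (MeasurableEquiv.prodAssoc : (GaugeField P k U1 × HiggsField P (k+1)) × (Prev P k × HiggsField P k) → _) := by
    funext r; rfl
  rw [e]
  unfold fieldsMeasure
  exact h4.comp h1

/-- **The `({u^{(j)}}, φ)`-smeared bracket**, `W(u, ψ) = ∫Π𝒟u^{(j)} ∫𝒟φ G({u^{(j)}}, u, φ, ψ)` (one integral over `Π𝒟u^{(j)} ⊗ 𝒟φ`): the complex weight whose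
push-forward along `(u, ψ) ↦ (Qu, ψ)` is the term's contribution to the density (gen 6's `smear51` for a general bracket).
[cite: BalabanImbrieJaffe1988, (5.1.1) p.277] -/
def smearG (G : Prev P k → GaugeField P k U1 → HiggsField P k → HiggsField P (k+1) → ℂ) (p : GaugeField P k U1 × HiggsField P (k+1)) : ℂ :=
  ∫ r, G r.1 p.1 r.2 p.2 ∂(prevMeasure P k).prod (volume : Measure (HiggsField P k))

/-- kernel: for a `fieldsMeasure ν`-integrable bracket and a bounded measurable `g`, the shuffled integrand `G·g(Qu, ψ)` is integrable on
`(ν ⊗ dψ) ⊗ (Π𝒟u^{(j)} ⊗ 𝒟φ)`. [cite: BalabanImbrieJaffe1988, (5.1.1) p.277] -/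
theorem integrable_shuffle_mul {Qu : GaugeField P k U1 → GaugeField P (k+1) U1} (hQu : Measurable Qu)
    {G : Prev P k → GaugeField P k U1 → HiggsField P k → HiggsField P (k+1) → ℂ}
    (hG : Integrable (fun q : Fields P k => G q.2.1 q.1 q.2.2.1 q.2.2.2) (fieldsMeasure ν))
    {g : GaugeField P (k+1) U1 × HiggsField P (k+1) → ℂ} (hg : Measurable g) {C : ℝ} (hC : ∀ z, ‖g z‖ ≤ C) :
    Integrable (fun r : (GaugeField P k U1 × HiggsField P (k+1)) × (Prev P k × HiggsField P k) => G r.2.1 r.1.1 r.2.2 r.1.2 * g (Qu r.1.1, r.1.2))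
      ((ν.prod volume).prod ((prevMeasure P k).prod volume)) := by
  have hS := measurePreserving_shuffle (P := P) (k := k) (ν := ν)
  have hK : Integrable (fun r : (GaugeField P k U1 × HiggsField P (k+1)) × (Prev P k × HiggsField P k) => G r.2.1 r.1.1 r.2.2 r.1.2)
      ((ν.prod volume).prod ((prevMeasure P k).prod volume)) :=
    (hS.integrable_comp hG.aestronglyMeasurable).2 hG
  exact hK.mul_bdd ((hg.comp ((hQu.comp (measurable_fst.comp measurable_fst)).prodMk (measurable_snd.comp measurable_fst))).aestronglyMeasurable)
    (Filter.Eventually.of_forall fun r => hC _)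

/-- **The smeared bracket is `ν ⊗ dψ`-integrable** for a `fieldsMeasure ν`-integrable bracket (Fubini). [cite: BalabanImbrieJaffe1988, (5.1.1) p.277] -/
theorem integrable_smearG {G : Prev P k → GaugeField P k U1 → HiggsField P k → HiggsField P (k+1) → ℂ}
    (hG : Integrable (fun q : Fields P k => G q.2.1 q.1 q.2.2.1 q.2.2.2) (fieldsMeasure ν)) : Integrable (smearG G) (ν.prod volume) := by
  have hK : Integrable (fun r : (GaugeField P k U1 × HiggsField P (k+1)) × (Prev P k × HiggsField P k) => G r.2.1 r.1.1 r.2.2 r.1.2)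
      ((ν.prod volume).prod ((prevMeasure P k).prod volume)) :=
    ((measurePreserving_shuffle (P := P) (k := k) (ν := ν)).integrable_comp hG.aestronglyMeasurable).2 hG
  exact hK.integral_prod_left

/-- **`∫_{ν⊗dψ} W(u, ψ) g(Qu, ψ) = ∫ν(du)∫Π𝒟u^{(j)}∫𝒟φ∫dψ G g(Qu, ψ)`** — the smeared bracket tested against `g(Qu, ψ)` is the four-fold iterated integral of
the bracket (Fubini along the shuffle; `g` bounded measurable, `Qu` measurable). [cite: BalabanImbrieJaffe1988, (5.1.1) p.277] -/
theorem integral_smearG_mul {Qu : GaugeField P k U1 → GaugeField P (k+1) U1} (hQu : Measurable Qu)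
    {G : Prev P k → GaugeField P k U1 → HiggsField P k → HiggsField P (k+1) → ℂ}
    (hG : Integrable (fun q : Fields P k => G q.2.1 q.1 q.2.2.1 q.2.2.2) (fieldsMeasure ν))
    {g : GaugeField P (k+1) U1 × HiggsField P (k+1) → ℂ} (hg : Measurable g) {C : ℝ} (hC : ∀ z, ‖g z‖ ≤ C) :
    ∫ p, smearG G p * g (Qu p.1, p.2) ∂ν.prod volume =
      ∫ U, ∫ prev, ∫ φ, ∫ ψ, G prev U φ ψ * g (Qu U, ψ) ∂volume ∂volume ∂prevMeasure P k ∂ν := by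
  have hS := measurePreserving_shuffle (P := P) (k := k) (ν := ν)
  have hK := integrable_shuffle_mul hQu hG hg hC
  -- left: `smearG·g` is the inner integral of the shuffled integrand
  have e1 : ∫ p, smearG G p * g (Qu p.1, p.2) ∂ν.prod volume =
      ∫ p, ∫ r, G r.1 p.1 r.2 p.2 * g (Qu p.1, p.2) ∂(prevMeasure P k).prod (volume : Measure (HiggsField P k)) ∂ν.prod volume := by
    refine integral_congr_ae (ae_of_all _ fun p => ?_)
    show smearG G p * g (Qu p.1, p.2) = _
    rw [smearG, ← integral_mul_const]
  rw [e1, ← integral_prod _ hK]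
  -- right: the four-fold iterated integral is the `fieldsMeasure`-integral, pulled back along the shuffle
  have hGg : Integrable (fun q : Fields P k => G q.2.1 q.1 q.2.2.1 q.2.2.2 * g (Qu q.1, q.2.2.2)) (fieldsMeasure ν) :=
    hG.mul_bdd ((hg.comp ((hQu.comp measurable_fst).prodMk (measurable_snd.comp (measurable_snd.comp measurable_snd)))).aestronglyMeasurable)
      (Filter.Eventually.of_forall fun q => hC _)
  rw [← integral_fieldsMeasure hGg]
  have hm : AEStronglyMeasurable (fun q : Fields P k => G q.2.1 q.1 q.2.2.1 q.2.2.2 * g (Qu q.1, q.2.2.2))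
      (Measure.map (fun r : (GaugeField P k U1 × HiggsField P (k+1)) × (Prev P k × HiggsField P k) => ((r.1.1, (r.2.1, (r.2.2, r.1.2))) : Fields P k))
        ((ν.prod volume).prod ((prevMeasure P k).prod volume))) := by
    rw [hS.map_eq]; exact hGg.aestronglyMeasurable
  rw [← hS.map_eq, integral_map hS.measurable.aemeasurable hm]

end Smear

/-! ## §2 The density for given one-integrand data -/

section RDG

variable {ι : Type*} {ν : Measure (GaugeField P k U1)} {terms : Finset ι} {Qu : GaugeField P k U1 → GaugeField P (k+1) U1}
variable {G : ι → Prev P k → GaugeField P k U1 → HiggsField P k → HiggsField P (k+1) → ℂ}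

/-- **THE DENSITY OF GIVEN ONE-INTEGRAND DATA, CONSTRUCTED**: the sum over the terms of the complex Radon–Nikodym densities w.r.t. `dv dψ` of the
push-forwards along `(u, ψ) ↦ (Qu, ψ)` of the smeared brackets `W_t·(ν ⊗ dψ)` (gen 6's `rnC`; gen 6's `rt51` is the case `G = ρ′·gaussWeight`).
[cite: BalabanImbrieJaffe1988, (5.1.1) p.277] -/
def rdg (ν : Measure (GaugeField P k U1)) (terms : Finset ι) (Qu : GaugeField P k U1 → GaugeField P (k+1) U1)
    (G : ι → Prev P k → GaugeField P k U1 → HiggsField P k → HiggsField P (k+1) → ℂ) (V : GaugeField P (k+1) U1) (ψ : HiggsField P (k+1)) : ℂ :=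
  ∑ t ∈ terms, rnC ν Qu (smearG (G t)) V ψ

/-- kernel: unfolding on the product. [cite: BalabanImbrieJaffe1988, (5.1.1) p.277] -/
theorem uncurry_rdg : uncurry (rdg ν terms Qu G) = fun q => ∑ t ∈ terms, uncurry (rnC ν Qu (smearG (G t))) q := by
  funext q; rfl

/-- kernel: the constructed density is jointly measurable. [cite: BalabanImbrieJaffe1988, (5.1.1) p.277] -/
theorem measurable_rdg : Measurable (uncurry (rdg ν terms Qu G)) := by
  rw [uncurry_rdg]; exact Finset.measurable_sum _ fun t _ => measurable_rnC _

/-- **The constructed density is `dv dψ`-integrable** (integrable brackets, `ν` s-finite). [cite: BalabanImbrieJaffe1988, (5.1.1) p.277] -/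
theorem integrable_rdg [SFinite ν] (hG : ∀ t ∈ terms, Integrable (fun q : Fields P k => G t q.2.1 q.1 q.2.2.1 q.2.2.2) (fieldsMeasure ν)) :
    Integrable (uncurry (rdg ν terms Qu G)) ((fieldMeasure P (k+1) U1).prod volume) := by
  rw [uncurry_rdg]
  exact integrable_finsetSum _ fun t ht => integrable_rnC (integrable_smearG (hG t ht))

/-- **THE CONSTRUCTED DENSITY SATISFIES THE ONE-INTEGRAND DISPLAY** `IsRDG ν terms Qu G (rdg ν terms Qu G)` — for `ν` s-finite, `Qu` measurable with
`ν.map Qu ≪ dv` (Haar regularity) and `fieldsMeasure ν`-integrable brackets: the finite sum leaves the integrals; per term gen 6's `integral_rnC_mul`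
(the `δ`-function) and `integral_smearG_mul` (Fubini). [cite: BalabanImbrieJaffe1988, (5.1.1) p.277] -/
theorem isRDG_rdg [SFinite ν] (hQu : Measurable Qu) (hac : ν.map Qu ≪ fieldMeasure P (k+1) U1)
    (hG : ∀ t ∈ terms, Integrable (fun q : Fields P k => G t q.2.1 q.1 q.2.2.1 q.2.2.2) (fieldsMeasure ν)) :
    IsRDG ν terms Qu G (rdg ν terms Qu G) := by
  intro g hg hb
  obtain ⟨C, hC⟩ := hb
  have hW : ∀ t ∈ terms, Integrable (smearG (G t)) (ν.prod volume) := fun t ht => integrable_smearG (hG t ht)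
  have It : ∀ t ∈ terms, Integrable (fun q => uncurry (rnC ν Qu (smearG (G t))) q * g q) ((fieldMeasure P (k+1) U1).prod volume) :=
    fun t ht => (integrable_rnC (hW t ht)).mul_bdd hg.aestronglyMeasurable (Filter.Eventually.of_forall hC)
  have e1 : ∀ v ψ, rdg ν terms Qu G v ψ * g (v, ψ) = ∑ t ∈ terms, uncurry (rnC ν Qu (smearG (G t))) (v, ψ) * g (v, ψ) := fun v ψ => by
    simp only [rdg, Finset.sum_mul, uncurry_apply_pair]
  simp_rw [e1]
  have hsum : Integrable (fun q => ∑ t ∈ terms, uncurry (rnC ν Qu (smearG (G t))) q * g q) ((fieldMeasure P (k+1) U1).prod volume) :=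
    integrable_finsetSum _ It
  have e2 : ∫ v, ∫ ψ, ∑ t ∈ terms, uncurry (rnC ν Qu (smearG (G t))) (v, ψ) * g (v, ψ) ∂volume ∂fieldMeasure P (k+1) U1 =
      ∫ q, ∑ t ∈ terms, uncurry (rnC ν Qu (smearG (G t))) q * g q ∂(fieldMeasure P (k+1) U1).prod volume := (integral_prod _ hsum).symm
  rw [e2, integral_finsetSum _ It]
  refine Finset.sum_congr rfl fun t ht => ?_
  rw [integral_rnC_mul hQu hac (hW t ht) hg hC]
  exact integral_smearG_mul hQu (hG t ht) hg hC

/-- **Instance `ν = ∫𝒟u δ_{Ax}(u)(·)`, printed `Q`** (Haar regularity: r18's `absolutelyContinuous_map_qU`; standing range). [cite: BalabanImbrieJaffe1988, (5.1.4) p.278] -/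
theorem isRDG_rdg_axial (hk : k + 1 ≤ P.m + P.K)
    (hG : ∀ t ∈ terms, Integrable (fun q : Fields P k => G t q.2.1 q.1 q.2.2.1 q.2.2.2) (fieldsMeasure (axialMeasure P k U1))) :
    IsRDG (axialMeasure P k U1) terms qU G (rdg (axialMeasure P k U1) terms qU G) :=
  isRDG_rdg measurable_qU (absolutelyContinuous_map_qU hk) hG

/-- **Instance `ν = 𝒟u`, printed `Q`** (r18's `map_qU_fieldMeasure`; standing range). [cite: BalabanImbrieJaffe1988, (5.1.1) p.277] -/
theorem isRDG_rdg_field (hk : k + 1 ≤ P.m + P.K)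
    (hG : ∀ t ∈ terms, Integrable (fun q : Fields P k => G t q.2.1 q.1 q.2.2.1 q.2.2.2) (fieldsMeasure (fieldMeasure P k U1))) :
    IsRDG (fieldMeasure P k U1) terms qU G (rdg (fieldMeasure P k U1) terms qU G) :=
  isRDG_rdg measurable_qU (by rw [map_qU_fieldMeasure hk]) hG

/-- **A `dv dψ`-integrable function satisfies the one-integrand display iff it equals the constructed density a.e.** [cite: BalabanImbrieJaffe1988, (5.1.1) p.277] -/
theorem isRDG_iff_ae_eq_rdg [SFinite ν] (hQu : Measurable Qu) (hac : ν.map Qu ≪ fieldMeasure P (k+1) U1)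
    (hG : ∀ t ∈ terms, Integrable (fun q : Fields P k => G t q.2.1 q.1 q.2.2.1 q.2.2.2) (fieldsMeasure ν))
    {ρL : GaugeField P (k+1) U1 → HiggsField P (k+1) → ℂ} (hi : Integrable (uncurry ρL) ((fieldMeasure P (k+1) U1).prod volume)) :
    IsRDG ν terms Qu G ρL ↔ uncurry ρL =ᵐ[(fieldMeasure P (k+1) U1).prod volume] uncurry (rdg ν terms Qu G) :=
  ⟨fun h => isRDG_unique h (isRDG_rdg hQu hac hG) hi (integrable_rdg hG),
    fun h => isRDG_congr_ae (isRDG_rdg hQu hac hG) (integrable_rdg hG) hi h⟩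

end RDG

/-! ## §3 The density for a given bracket of line 1 of (5.9.6) -/

section DT

variable {ι : Type*} {ν : Measure (GaugeField P k U1)} [IsProbabilityMeasure ν] {terms : Finset ι} {Λ : ι → Finset (PBond P (k+1))}
variable {J : ι → Prev P k → GaugeField P k U1 → GaugeField P (k+1) U1 → HiggsField P k → HiggsField P (k+1) → ℂ}

/-- **THE DENSITY OF A BRACKET OF LINE 1 OF (5.9.6), CONSTRUCTED** — `rdg` of the bracket read in the untranslated variable,
`G_t({u^{(j)}}, u, φ, ψ) = J_t({u^{(j)}}, u′_{Λ_t}(u), Qu, φ, ψ)`.  p. 282: *"a different density is obtained by replacing ψ′ with ψ"* — this is that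
density, for the renamed bracket. [cite: BalabanImbrieJaffe1988, (5.9.6) p.297] -/
def rdt (ν : Measure (GaugeField P k U1)) (terms : Finset ι) (Λ : ι → Finset (PBond P (k+1)))
    (J : ι → Prev P k → GaugeField P k U1 → GaugeField P (k+1) U1 → HiggsField P k → HiggsField P (k+1) → ℂ) :
    GaugeField P (k+1) U1 → HiggsField P (k+1) → ℂ :=
  rdg ν terms qU fun t prev U φ ψ => J t prev (uCut qU (Λ t) U) (qU U) φ ψ

/-- **It is `dv dψ`-integrable** (bracket integrable in the untranslated variable). [cite: BalabanImbrieJaffe1988, (5.9.6) p.297] -/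
theorem integrable_rdt (hJ : ∀ t ∈ terms, Integrable (fun q : Fields P k => J t q.2.1 (uCut qU (Λ t) q.1) (qU q.1) q.2.2.1 q.2.2.2) (fieldsMeasure ν)) :
    Integrable (uncurry (rdt ν terms Λ J)) ((fieldMeasure P (k+1) U1).prod volume) :=
  integrable_rdg hJ

/-- **IT SATISFIES LINE 1 OF (5.9.6) WITH THE GIVEN BRACKET**: `IsDT ν terms Λ qU J (rdt ν terms Λ J)` for a substitution-invariant probability law `ν`
with `ν.map Q ≪ dv`, and brackets integrable in the untranslated variable (`isRDG_rdg`, then `BIJ88Eq596Passage.isDT_of_isRDG` and `(u′_Λ·Q^{s*}(cutoff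
v′))′_Λ = u′_Λ`, `Q(u′_Λ·Q^{s*}(cutoff v′)) = v_Λ`; standing range). [cite: BalabanImbrieJaffe1988, (5.9.6) p.297] -/
theorem isDT_rdt (hk : k + 1 ≤ P.m + P.K) (hν : ∀ w, ν.map (fun U => surfMul U w) = ν) (hac : ν.map qU ≪ fieldMeasure P (k+1) U1)
    (hJ : ∀ t ∈ terms, Integrable (fun q : Fields P k => J t q.2.1 (uCut qU (Λ t) q.1) (qU q.1) q.2.2.1 q.2.2.2) (fieldsMeasure ν)) :
    IsDT ν terms Λ qU J (rdt ν terms Λ J) := by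
  have h1 := isDT_of_isRDG (G := fun t prev U φ ψ => J t prev (uCut qU (Λ t) U) (qU U) φ ψ) hk hν (isRDG_rdg measurable_qU hac hJ) hJ Λ
  refine h1.congr fun t _ prev U v' φ ψ => ?_
  simp only [cutoff_vCut, uCut_translCut hk, qU_translCut' hk]

/-- **Instance `ν = ∫𝒟u δ_{Ax}(u)(·)`** (the measure of (5.9.6)). [cite: BalabanImbrieJaffe1988, (5.9.6) p.297] -/
theorem isDT_rdt_axial (hk : k + 1 ≤ P.m + P.K)
    (hJ : ∀ t ∈ terms, Integrable (fun q : Fields P k => J t q.2.1 (uCut qU (Λ t) q.1) (qU q.1) q.2.2.1 q.2.2.2) (fieldsMeasure (axialMeasure P k U1))) :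
    IsDT (axialMeasure P k U1) terms Λ qU J (rdt (axialMeasure P k U1) terms Λ J) :=
  isDT_rdt hk axialMeasure_map_surfMul (absolutelyContinuous_map_qU hk) hJ

omit [IsProbabilityMeasure ν] in
/-- **Instance `ν = 𝒟u`**. [cite: BalabanImbrieJaffe1988, (5.9.6) p.297] -/
theorem isDT_rdt_field (hk : k + 1 ≤ P.m + P.K)
    (hJ : ∀ t ∈ terms, Integrable (fun q : Fields P k => J t q.2.1 (uCut qU (Λ t) q.1) (qU q.1) q.2.2.1 q.2.2.2) (fieldsMeasure (fieldMeasure P k U1))) :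
    IsDT (fieldMeasure P k U1) terms Λ qU J (rdt (fieldMeasure P k U1) terms Λ J) :=
  isDT_rdt hk map_surfMul_fieldMeasure (by rw [map_qU_fieldMeasure hk]) hJ

/-- **A `dv dψ`-integrable function satisfies line 1 of (5.9.6) with the bracket `J` iff it equals the constructed density a.e.**
[cite: BalabanImbrieJaffe1988, (5.9.6) p.297] -/
theorem isDT_iff_ae_eq_rdt (hk : k + 1 ≤ P.m + P.K) (hν : ∀ w, ν.map (fun U => surfMul U w) = ν) (hac : ν.map qU ≪ fieldMeasure P (k+1) U1)
    (hJ : ∀ t ∈ terms, Integrable (fun q : Fields P k => J t q.2.1 (uCut qU (Λ t) q.1) (qU q.1) q.2.2.1 q.2.2.2) (fieldsMeasure ν))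
    {ρL : GaugeField P (k+1) U1 → HiggsField P (k+1) → ℂ} (hi : Integrable (uncurry ρL) ((fieldMeasure P (k+1) U1).prod volume)) :
    IsDT ν terms Λ qU J ρL ↔ uncurry ρL =ᵐ[(fieldMeasure P (k+1) U1).prod volume] uncurry (rdt ν terms Λ J) :=
  ⟨fun h => isDT_unique h (isDT_rdt hk hν hac hJ) hi (integrable_rdt hJ),
    fun h => isDT_congr_ae (isDT_rdt hk hν hac hJ) (integrable_rdt hJ) hi h⟩

end DT

end

end Literature.MathematicalPhysics.QuantumFieldTheory.BalabanImbrieJaffe1984to88.BIJ88Eq596Exists
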